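import Mathlib
import Literature.MeasureTheory.Integral.RegionBetweenIntegral
import HarnessLib

/-!
# The centre of mass of a plane region (Marsden–Weinstein, Sect. 9.4)

**Statement.** The centre of mass (centroid) of a plate of uniform density occupying a plane region `R ⊆ ℝ × ℝ` is
the measure-theoretic mean position `(x̄, ȳ) = ((∫_R x dA) / |R|, (∫_R y dA) / |R|)` (`plateCentroid`, shown equal to
Mathlib's set average `⨍`).  We prove the boxed statements of Marsden–Weinstein, *Calculus II*, Sect. 9.4:

* the consolidation principle (p. 436): moments are additive, so the centroid of a body divided into two parts is
  the mass-weighted mean of the parts' centroids (`volume_smul_plateCentroid`, `plateCentroid_union`);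
* the symmetry principle (p. 438): a plate symmetric in the line `x = c` (resp. `y = c`) has `x̄ = c` (resp.
  `ȳ = c`) (`plateCentroid_fst_of_symmetric`, `plateCentroid_snd_of_symmetric`);
* formula (5) (box p. 439), the centre of mass of the region under the graph of a non-negative `f` on `[a, b]`:
  `x̄ = (∫ x in a..b, x f x) / ∫ x in a..b, f x`, `ȳ = (½ ∫ x in a..b, (f x)²) / ∫ x in a..b, f x`
  (`plateCentroid_regionUnderGraph`), obtained from the genuinely two-dimensional definition by Fubini over the region
  (`setIntegral_fst_regionUnderGraph`, `setIntegral_snd_regionUnderGraph`, `volume_regionUnderGraph`);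
* the worked examples: `x²` on `[0, 1]` has centroid `(3/4, 3/10)` (Example 5) and the unit half-disc has centroid
  `(0, 4 / (3 π))` (Example 6).

No positivity-of-area side condition is needed in formula (5): when `∫ f = 0` both sides are `0` by the `x / 0 = 0`
convention, which is also the value of an average over a null set.  (Combined with the shell and disk methods this is
Pappus' theorem, op. cit. p. 453, Exercise 38: `2 π x̄ |R| = 2 π ∫ x f x` and `2 π ȳ |R| = π ∫ f²`.)

**Why here.** Centroids (and first moments generally) of profiles and cross-sections are among the commonest
"numbers" a client cell wants certified; a certified quadrature of `∫ x f` and `∫ f` is only a certified CENTROID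
once the reduction from the two-dimensional definition to those one-dimensional integrals is a theorem.  The tree
has Fubini over regions between graphs (`Literature.MeasureTheory.Integral.RegionBetweenIntegral`), which we use;
Mathlib has averages (`⨍`) but no centre-of-mass statements.

Honest framing: this is infrastructure for shared numerical engines serving client cells; rigour lives in the
verifiers (the kernel-checked certificate that consumes the one-dimensional integrals); every published number
belongs to a client cell's ledger, not to the engines group.  Nothing here is claimed as new mathematics.

Topic `Literature/MeasureTheory/Integral`; namespace `Literature.MeasureTheory.Integral`.

References: [MarsdenWeinstein1985] J. Marsden, A. Weinstein, *Calculus II*, Springer 1985, Sect. 9.4 (pp. 435–441)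
and p. 453.
-/

namespace Literature.MeasureTheory.Integral

open _root_.MeasureTheory _root_.MeasureTheory.Measure Set Real Filter
open scoped ENNReal Topology

noncomputable section

/-! ### The centroid of a plane region -/

/-- The centre of mass of a plate of uniform density occupying the region `R`: the mean position
`((∫_R x) / |R|, (∫_R y) / |R|)` (junk value `0` in a coordinate whose moment integral diverges, and `(0, 0)` for
`|R| = 0` or `|R| = ∞`). [cite: MarsdenWeinstein1985, Sect. 9.4 p. 439] -/
def plateCentroid (R : Set (ℝ × ℝ)) : ℝ × ℝ :=
  ((volume R).toReal⁻¹ * ∫ p in R, p.1, (volume R).toReal⁻¹ * ∫ p in R, p.2)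

/-- The centroid is the pair of set averages `(⨍_R x, ⨍_R y)`. [cite: MarsdenWeinstein1985, Sect. 9.4 p. 439] -/
theorem plateCentroid_eq_setAverage (R : Set (ℝ × ℝ)) :
    plateCentroid R = (⨍ p in R, p.1, ⨍ p in R, p.2) := by
  simp only [plateCentroid, setAverage_eq, smul_eq_mul, measureReal_def]

/-! ### The consolidation principle -/

/-- Mass times centroid is the first moment: `|R| • (x̄, ȳ) = (∫_R x, ∫_R y)` for a region of finite area.
[cite: MarsdenWeinstein1985, Sect. 9.4 p. 436] -/
theorem volume_smul_plateCentroid {R : Set (ℝ × ℝ)} (hfin : volume R ≠ ∞) :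
    (volume R).toReal • plateCentroid R = (∫ p in R, p.1, ∫ p in R, p.2) := by
  by_cases h0 : volume R = 0
  · have hres : volume.restrict R = 0 := Measure.restrict_eq_zero.mpr h0
    simp [plateCentroid, hres, h0, Prod.mk_zero_zero]
  · have hne : (volume R).toReal ≠ 0 := ENNReal.toReal_ne_zero.mpr ⟨h0, hfin⟩
    simp only [plateCentroid, Prod.smul_mk, smul_eq_mul]
    rw [mul_inv_cancel_left₀ hne, mul_inv_cancel_left₀ hne]

/-- **Consolidation principle** (Marsden–Weinstein Sect. 9.4, box p. 436): if a plate `R ∪ S` is divided into two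
disjoint measurable parts of finite area (with finite first moments), its centroid is located as if it consisted of
two point masses `|R|` at the centroid of `R` and `|S|` at the centroid of `S`:
`|R ∪ S| • plateCentroid (R ∪ S) = |R| • plateCentroid R + |S| • plateCentroid S`.
[cite: MarsdenWeinstein1985, Sect. 9.4 p. 436] -/
theorem plateCentroid_union {R S : Set (ℝ × ℝ)} (hS : MeasurableSet S) (hRS : Disjoint R S)
    (hRfin : volume R ≠ ∞) (hSfin : volume S ≠ ∞)
    (hR1 : IntegrableOn (fun p : ℝ × ℝ => p.1) R) (hS1 : IntegrableOn (fun p : ℝ × ℝ => p.1) S)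
    (hR2 : IntegrableOn (fun p : ℝ × ℝ => p.2) R) (hS2 : IntegrableOn (fun p : ℝ × ℝ => p.2) S) :
    (volume (R ∪ S)).toReal • plateCentroid (R ∪ S) =
      (volume R).toReal • plateCentroid R + (volume S).toReal • plateCentroid S := by
  have hUfin : volume (R ∪ S) ≠ ∞ :=
    ((measure_union_le R S).trans_lt (ENNReal.add_lt_top.mpr ⟨hRfin.lt_top, hSfin.lt_top⟩)).ne
  rw [volume_smul_plateCentroid hUfin, volume_smul_plateCentroid hRfin, volume_smul_plateCentroid hSfin,
    setIntegral_union hRS hS hR1 hS1, setIntegral_union hRS hS hR2 hS2, Prod.mk_add_mk]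

/-! ### The symmetry principle -/

/-- **Symmetry principle**, vertical axis (Marsden–Weinstein Sect. 9.4, box p. 438): if the line `x = c` is an axis
of symmetry of a measurable plate `R` of finite non-zero area (with finite first moment), then `x̄ = c`.
[cite: MarsdenWeinstein1985, Sect. 9.4 p. 438] -/
theorem plateCentroid_fst_of_symmetric {R : Set (ℝ × ℝ)} (h0 : volume R ≠ 0) (hfin : volume R ≠ ∞)
    (hint : IntegrableOn (fun p : ℝ × ℝ => p.1) R) {c : ℝ}
    (hsymm : ∀ p : ℝ × ℝ, (2 * c - p.1, p.2) ∈ R ↔ p ∈ R) : (plateCentroid R).1 = c := by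
  set σ : ℝ × ℝ → ℝ × ℝ := Prod.map (fun t => 2 * c - t) id with hσ
  have hmp : MeasurePreserving σ volume volume :=
    (measurePreserving_sub_left volume (2 * c)).prod (MeasurePreserving.id volume)
  have hemb : MeasurableEmbedding σ := (measurableEmbedding_subLeft (2 * c)).prodMap MeasurableEmbedding.id
  have hpre : σ ⁻¹' R = R := by
    ext ⟨x, y⟩
    simpa [hσ] using hsymm (x, y)
  have h1 := hmp.setIntegral_preimage_emb hemb (fun p : ℝ × ℝ => p.1) R
  rw [hpre] at h1
  simp only [hσ, Prod.map_fst] at h1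
  -- `h1 : ∫ p in R, (2 c - p.1) = ∫ p in R, p.1`
  have hc : IntegrableOn (fun _ : ℝ × ℝ => 2 * c) R := integrableOn_const hfin
  rw [integral_sub hc hint, setIntegral_const, smul_eq_mul, measureReal_def] at h1
  have hne : (volume R).toReal ≠ 0 := ENNReal.toReal_ne_zero.mpr ⟨h0, hfin⟩
  simp only [plateCentroid]
  field_simp
  linarith

/-- **Symmetry principle**, horizontal axis: if the line `y = c` is an axis of symmetry of a measurable plate `R` of
finite non-zero area (with finite first moment), then `ȳ = c`. [cite: MarsdenWeinstein1985, Sect. 9.4 p. 438] -/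
theorem plateCentroid_snd_of_symmetric {R : Set (ℝ × ℝ)} (h0 : volume R ≠ 0) (hfin : volume R ≠ ∞)
    (hint : IntegrableOn (fun p : ℝ × ℝ => p.2) R) {c : ℝ}
    (hsymm : ∀ p : ℝ × ℝ, (p.1, 2 * c - p.2) ∈ R ↔ p ∈ R) : (plateCentroid R).2 = c := by
  set σ : ℝ × ℝ → ℝ × ℝ := Prod.map id (fun t => 2 * c - t) with hσ
  have hmp : MeasurePreserving σ volume volume :=
    (MeasurePreserving.id volume).prod (measurePreserving_sub_left volume (2 * c))
  have hemb : MeasurableEmbedding σ := MeasurableEmbedding.id.prodMap (measurableEmbedding_subLeft (2 * c))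
  have hpre : σ ⁻¹' R = R := by
    ext ⟨x, y⟩
    simpa [hσ] using hsymm (x, y)
  have h1 := hmp.setIntegral_preimage_emb hemb (fun p : ℝ × ℝ => p.2) R
  rw [hpre] at h1
  simp only [hσ, Prod.map_snd] at h1
  have hc : IntegrableOn (fun _ : ℝ × ℝ => 2 * c) R := integrableOn_const hfin
  rw [integral_sub hc hint, setIntegral_const, smul_eq_mul, measureReal_def] at h1
  have hne : (volume R).toReal ≠ 0 := ENNReal.toReal_ne_zero.mpr ⟨h0, hfin⟩
  simp only [plateCentroid]
  field_simp
  linarith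

/-! ### The region under a graph: formula (5) -/

/-- The plate "under the graph of `f` on `[a, b]`": `{(x, y) | a ≤ x ≤ b, 0 ≤ y ≤ f x}` (the closed region between
the graphs of `0` and `f`). [cite: MarsdenWeinstein1985, Sect. 9.4 p. 439] -/
def regionUnderGraph (f : ℝ → ℝ) (a b : ℝ) : Set (ℝ × ℝ) :=
  closedRegionBetween (fun _ => 0) f (Icc a b)

/-- The area of the region under a continuous non-negative graph is `∫ x in a..b, f x`.
[cite: MarsdenWeinstein1985, Sect. 9.4 p. 439] -/
theorem volume_regionUnderGraph {f : ℝ → ℝ} {a b : ℝ} (hab : a ≤ b) (hf : ContinuousOn f (Icc a b))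
    (hf0 : ∀ x ∈ Icc a b, 0 ≤ f x) :
    volume (regionUnderGraph f a b) = ENNReal.ofReal (∫ x in a..b, f x) := by
  have hK : IsCompact (regionUnderGraph f a b) := isCompact_closedRegionBetween continuousOn_const hf
  have hfin : volume (regionUnderGraph f a b) ≠ ∞ := hK.measure_lt_top.ne
  have h1 : ∫ _ in regionUnderGraph f a b, (1 : ℝ) = ∫ x in a..b, f x := by
    rw [regionUnderGraph, setIntegral_closedRegionBetween_eq_iterated_of_continuousOn hab continuousOn_const hf
      hf0 continuousOn_const]
    refine intervalIntegral.integral_congr fun x _ => ?_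
    simp
  rw [setIntegral_const, smul_eq_mul, mul_one, measureReal_def] at h1
  rw [← ENNReal.ofReal_toReal hfin, h1]

/-- The first moment about the `y` axis of the region under a graph: `∫_R x dA = ∫ x in a..b, x f x` (Fubini).
[cite: MarsdenWeinstein1985, Sect. 9.4 p. 439] -/
theorem setIntegral_fst_regionUnderGraph {f : ℝ → ℝ} {a b : ℝ} (hab : a ≤ b) (hf : ContinuousOn f (Icc a b))
    (hf0 : ∀ x ∈ Icc a b, 0 ≤ f x) :
    ∫ p in regionUnderGraph f a b, p.1 = ∫ x in a..b, x * f x := by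
  rw [regionUnderGraph, setIntegral_closedRegionBetween_eq_iterated_of_continuousOn hab continuousOn_const hf hf0
    continuousOn_fst]
  refine intervalIntegral.integral_congr fun x _ => ?_
  simp [mul_comm]

/-- The first moment about the `x` axis of the region under a graph: `∫_R y dA = ½ ∫ x in a..b, (f x)²` (Fubini).
[cite: MarsdenWeinstein1985, Sect. 9.4 p. 439] -/
theorem setIntegral_snd_regionUnderGraph {f : ℝ → ℝ} {a b : ℝ} (hab : a ≤ b) (hf : ContinuousOn f (Icc a b))
    (hf0 : ∀ x ∈ Icc a b, 0 ≤ f x) :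
    ∫ p in regionUnderGraph f a b, p.2 = 2⁻¹ * ∫ x in a..b, f x ^ 2 := by
  rw [regionUnderGraph, setIntegral_closedRegionBetween_eq_iterated_of_continuousOn hab continuousOn_const hf hf0
    continuousOn_snd, ← intervalIntegral.integral_const_mul]
  refine intervalIntegral.integral_congr fun x _ => ?_
  simp only [integral_id]
  ring

/-- **Centre of mass of the region under a graph** (Marsden–Weinstein Sect. 9.4, box p. 439, formula (5)): for a
continuous non-negative `f` on `[a, b]`, `a ≤ b`, the plate under the graph has
`x̄ = (∫ x in a..b, x f x) / ∫ x in a..b, f x` and `ȳ = (½ ∫ x in a..b, (f x)²) / ∫ x in a..b, f x`.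
[cite: MarsdenWeinstein1985, Sect. 9.4 p. 439 (5)] -/
theorem plateCentroid_regionUnderGraph {f : ℝ → ℝ} {a b : ℝ} (hab : a ≤ b) (hf : ContinuousOn f (Icc a b))
    (hf0 : ∀ x ∈ Icc a b, 0 ≤ f x) :
    plateCentroid (regionUnderGraph f a b) =
      ((∫ x in a..b, x * f x) / ∫ x in a..b, f x, (2⁻¹ * ∫ x in a..b, f x ^ 2) / ∫ x in a..b, f x) := by
  simp only [plateCentroid, volume_regionUnderGraph hab hf hf0, setIntegral_fst_regionUnderGraph hab hf hf0,
    setIntegral_snd_regionUnderGraph hab hf hf0,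
    ENNReal.toReal_ofReal (intervalIntegral.integral_nonneg hab hf0), div_eq_inv_mul]

/-- Marsden–Weinstein Sect. 9.4 Example 5: the region under `x²` on `[0, 1]` has centre of mass `(3/4, 3/10)`.
[cite: MarsdenWeinstein1985, Sect. 9.4 Example 5] -/
theorem plateCentroid_regionUnderGraph_sq_unit :
    plateCentroid (regionUnderGraph (fun x => x ^ 2) 0 1) = (3 / 4, 3 / 10) := by
  rw [plateCentroid_regionUnderGraph zero_le_one (by fun_prop) (fun x _ => by positivity)]
  have h1 : (fun x : ℝ => x * x ^ 2) = fun x => x ^ 3 := by funext x; ring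
  have h2 : (fun x : ℝ => (x ^ 2) ^ 2) = fun x => x ^ 4 := by funext x; ring
  rw [h1, h2, integral_pow, integral_pow, integral_pow]
  norm_num

/-- Marsden–Weinstein Sect. 9.4 Example 6: the half-disc under `√(1 - x²)` on `[-1, 1]` has centre of mass
`(0, 4 / (3 π))` (the area `π / 2` is Mathlib's `integral_sqrt_one_sub_sq`).
[cite: MarsdenWeinstein1985, Sect. 9.4 Example 6] -/
theorem plateCentroid_halfDisc :
    plateCentroid (regionUnderGraph (fun x => √(1 - x ^ 2)) (-1) 1) = (0, 4 / (3 * π)) := by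
  rw [plateCentroid_regionUnderGraph (by norm_num) (by fun_prop) (fun x _ => sqrt_nonneg _)]
  -- the odd moment vanishes
  have hodd : ∫ x in (-1:ℝ)..1, x * √(1 - x ^ 2) = 0 := by
    have h := intervalIntegral.integral_comp_neg (a := (-1:ℝ)) (b := 1) (fun x : ℝ => x * √(1 - x ^ 2))
    simp only [neg_neg, even_two, Even.neg_pow, neg_mul, intervalIntegral.integral_neg] at h
    linarith
  -- `∫ (√(1 - x²))² = ∫ (1 - x²) = 4/3` on `[-1, 1]`
  have hsq : ∫ x in (-1:ℝ)..1, √(1 - x ^ 2) ^ 2 = 4 / 3 := by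
    have h : ∫ x in (-1:ℝ)..1, √(1 - x ^ 2) ^ 2 = ∫ x in (-1:ℝ)..1, (1 - x ^ 2) := by
      refine intervalIntegral.integral_congr fun x hx => ?_
      rw [uIcc_of_le (by norm_num), mem_Icc] at hx
      exact sq_sqrt (by nlinarith)
    rw [h, intervalIntegral.integral_sub (by apply Continuous.intervalIntegrable; fun_prop)
        (by apply Continuous.intervalIntegrable; fun_prop), intervalIntegral.integral_const, integral_pow]
    norm_num
  rw [hodd, hsq, integral_sqrt_one_sub_sq]
  ext
  · simp
  · field_simp

end

end Literature.MeasureTheory.Integral
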